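import Literature.AlgebraicGeometry.ShimuraVarieties.UnitaryShimuraCanonicalModelPrinted
import Literature.AlgebraicGeometry.ShimuraVarieties.UnitaryShimuraCanonicalModelPrintedForm
import Literature.NumberTheory.ComplexMultiplication.ComplexReflexField
import Summits.HodgeConjecture.CorCM.HypDel.HypDelGaloisCaseOfF1
import Summits.HodgeConjecture.CorCM.HypDel.A1ReflexCompositumModelOfF1
import Summits.HodgeConjecture.HodgeConjecture.Theses.HCCMUnconditional
import HarnessLib

/-!
v4 = v3 (8dd644baaa0f3f21) + the GATE-SHAPE HEAD `HDel_proof : HCCMUnconditional.HDel` (route crux stmt-HodgeConjecture-24835;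
`HDel` = pack `HypDel` = `canonicalModel_exists_printed` by `rfl`) := `canonicalModel_exists_printed_of (A) (B)`; no stub touched.
v3 = v2 with stub (A) `stub_reflexCompositumModel` FILLED BY NAME := `stub_reflexCompositumModel_of_F1 stub_F1` (A-p05,
p597370; ALL CM fields L) and `stub_nonGaloisResidual` DERIVED in-file from (A) + (B); sorries 4 → 2 = `stub_F1` (row I-1
printed citation, B-side) · `stub_reflexDescent` (B, TIER-G residual, non-Galois L only, not consumed by the headline).
READING: hDel♭ ⇐ F1 and hDel ⇐ F1 + (B), both in the kernel.
v2 = v1 (785cc48e2d31c68c) with `stub_galoisCase` (= hDel♭ pointwise) FILLED BY NAME := `HypDel.galoisCase_of_F1 stub_F1`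
(A-p06, p596634) modulo the NEW fact stub `stub_F1 : Aux.canonicalModel_exists_printed` (row I-1, B-side debt); statements of
v1 byte-identical; stub (A) docstring wording «mirror» clarified (ref1 rider).  Sorries 4 → 4 = (A) · (B residual) ·
nonGaloisResidual (TIER G) · F1 (fact).  HC_CM is proved only modulo the 7 printed citations until rung 0 closes.

# Line `a1-reflex-compositum` for the binder `hDel` → `HypDel`
# (`UnitaryCanonicalModel.canonicalModel_exists_printed`; Deligne 1979 2.2.5 / Cor. 2.7.21 for compact `U(2,1)`)

SKELETON (crux-workfile DRAFT; cell `hodgecm-mathlib`, fan A, rung A-I; seat `hodgecm-mathlib-A-plan1`; home copy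
`A-plan/lines/a1-reflex-compositum.lean` until the route `HCCMUnconditional` is born and the `HypDel` stmt id exists,
then `ledger crux write <HypDel item> Lines/a1-reflex-compositum.lean`).  HC_CM is proved only modulo the 7 printed
citations until rung 0 closes; this file re-derives ONE of them (`hDel`) from two interface statements and isolates
exactly where Deligne's abelian-type descent (1979, 2.7.10–2.7.21, «TIER G») is load-bearing.  Head of record:
`HypDel_of` = `canonicalModel_exists_printed_of` below (`PrintedCitationHypotheses.HypDel` unfolds to
`canonicalModel_exists_printed` by `rfl`; the alias is added the minute the certified pack module is built on the farm).

WHY THIS LINE.  The printed existence proof for the datum `(G,X) = (Res_{L⁺/ℚ} U(H), 𝔹²)` (abelian type, NOT Hodge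
type: `h_U` has weight `0`) has two mechanisms of very different weight.  (A) «CHAIN B» (B-plan2 `B1-SPEC.md` §1):
Hodge-type existence for the auxiliary datum `(G̃, X̃) = (G × T₀, h_U × h_Φ) ↪ GSp(W₀ ⊕ V)` with `Φ` a CM type of
`L` adapted to `(H, τ)` (row I-1 = `Aux.canonicalModel_exists_printed`, Deligne 1979 2.3.1 / Deligne 1971 4.21;
RSZ §3, [Liu2021] App. C (C.4)–(C.6), Lemma C.18), then Deligne 1971 Prop. 5.11 (central twist by
`δ = 1 × h_Φ⁻¹`, row I-2 F2a) and Cor. 5.7 (closed sub-datum `(G, h_U) ↪ (G̃, h_U × 1)`, row I-2 F2b) give an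
`E`-form of `Sc.Mc` with Shimura reciprocity (62) for `Aut(ℂ/E)`, for every number field `E ⊂ ℂ` containing the
reflex compositum `E♯_Φ = τ(L)·E*(Φ)` ([Liu2021] Lemma C.14) — `stub_reflexCompositumModel`, stated in EXACTLY
the consumer shape of F2b («the §0 formula with `Aut(ℂ/E)`»).  (B) DESCENT of such forms from `E♯_Φ` to the reflex
field `E(G,X) = τ(L)` — `stub_reflexDescent` — which for `L/ℚ` GALOIS is EMPTY (`E*(Φ) = traceField Φ ⊆ τ(L)`,
Shimura §8.3 Prop. 28 = tree `traceField_le_fieldRange`; PROVED below as `reflexDescent_of_isGalois`) and for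
non-Galois `L` IS Deligne 1979 §2.7 (or Milne–Shih conjugation): [Liu2021] Rem. C.15 «`⋂_Φ E♯_Φ` may strictly
contain `τ(L)`», so even Deligne 1971 Prop. 5.10 does not close the gap.  The headline consumes `hDel` only at
`L = K F`, `F` Galois CM with `6 ≤ [F:ℚ]`, so under the director's ruling D-I2 (β: Galois edition `hDel♭`) stub (B)
is deleted by the edition and TIER G leaves the critical path; under α it is the declared TIER-G crux
(`stub_nonGaloisResidual` below is its case-split form).  Both shapes are kernel-linked here:
`canonicalModel_exists_printed_of : (A) → (B) → hDel`, `canonicalModel_exists_printed_of_cases :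
GaloisCase → NonGaloisResidual → hDel`, `galoisCase_of_reflexCompositumModel : (A) → GaloisCase` (PROVED).
The `smooth` / `projective` clauses of the print are NOT carried by the stubs: they descend along `τ`
(`canonicalModel_exists_printed_iff_form`, PROVED in the tree).

References: [Deligne1979ShimuraVarieties] 2.2.5, 2.3.1, 2.7.10–2.7.21; [Deligne1971TravauxShimura] 4.21, 5.7,
5.10, 5.11, §6; [Liu2021] (arXiv:2102.11518) App. C, C.1–C.18, Rem. C.2, Lem. C.14, Rem. C.15;
[RapoportSmithlingZhang2017] (arXiv:1710.06962) §3; [Kottwitz1992] §5, §8; [Milne2005ShimuraVarieties] §12 (62),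
Thm. 14.13–Prop. 14.16; [Shimura1998] §8.3 Prop. 28.
-/

set_option autoImplicit false

noncomputable section

open Function MulAction NumberField IsDedekindDomain CategoryTheory CategoryTheory.Limits Matrix
  AlgebraicGeometry
open scoped Matrix ComplexOrder
open Literature.AlgebraicGeometry.Motives
open Literature.NumberTheory.Automorphic Literature.NumberTheory.Automorphic.UnitaryGroup
open Literature.NumberTheory.Automorphic.Liu2021.AppendixC (C5.OpenCompactSubgroup C5.SmallLevel)
open Literature.Geometry.ComplexHyperbolic Literature.Geometry.ComplexHyperbolic.BallModel
open Literature.NumberTheory.Automorphic.ShimuraDissection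
open Literature.AlgebraicGeometry.ShimuraVarieties hiding hermForm -- (v4: the route import brings a second `hermForm` into scope; v1–v3 resolved to `UnitaryGroup.hermForm`)
open Literature.AlgebraicGeometry.ShimuraVarieties.UnitaryCanonicalModel
open Literature.NumberTheory.ComplexMultiplication (traceField traceField_le_fieldRange)

namespace Summit.HodgeConjecture.CorCM.Cruxes.HypDel.ReflexCompositum

/-! ## The two mechanism stubs: (A) Chain B over the reflex composita, (B) descent to the reflex field -/

/-- **fact stub `stub_F1` (PRINTED-CITATION FACT = row I-1 of `B1-SPEC.md`, B-side debt; NOT fan-A mathematics and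
NOT a prover target of fan A):** the named fact `Aux.canonicalModel_exists_printed` — canonical model with Shimura
reciprocity at CM points for the AUXILIARY Hodge-type datum attached to `(L, H, τ)` ([Deligne1979ShimuraVarieties] 2.3.1,
[Kottwitz1992] §5, §8), typed by B-typ03 (p590789 / p591128).  It is discharged only by a landed
`canonicalModel_exists_printed`-for-`Aux` `_holds` theorem (rung 0 of fan B); until then it is the honest residue of
`hDel♭`: with it, `stub_galoisCase` below is CLOSED BY NAME (A-p06, p596634).  Strategy hint: none — cite, do not attack.
Why it might fail: a printed theorem; only a typing slip in conventions C-Φ / C-r (see stub (A)) could make the typed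
`Prop` differ from the print, and then it is unprovable, not false-and-provable.
[cite: Deligne1979ShimuraVarieties, 2.3.1] [cite: Kottwitz1992, §5, §8] -/
theorem stub_F1 : Literature.AlgebraicGeometry.ShimuraVarieties.UnitaryCanonicalModel.Aux.canonicalModel_exists_printed := by
  sorry

/-- **stub (A) `stub_reflexCompositumModel` (INTERFACE — consumer shape of CHAIN B = rows I-1 (F1
`Aux.canonicalModel_exists_printed`) ∘ I-2 (F2a `Aux.centralTwist_weaklyCanonical_printed`, F2b
`Aux.subdatum_weaklyCanonical_printed`) of `B1-SPEC.md`, to be typed by B-typ03; reciprocity at CM points inside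
F1 = row II-1 main theorem of CM):** at every datum of `hDel` and every complex record system `Sc`, THERE IS a CM
type `Φ` of `L` (the adapted one, `Aux.exists_isAdapted`) such that for every number field `E ⊂ ℂ` (embedding `ιE`)
containing `τ(L)` and `E*(Φ) = traceField Φ` — i.e. `E ⊇ E♯_Φ` — the tower `K ↦ Sc.Mc_K` has an `E`-form
`(M, e : M ⊗_{E,ιE} ℂ ≅ Sc.Mc)` on whose complex points `Aut(ℂ/ιE(E))` acts at the diagonal special pairs by
Shimura reciprocity (62), `σ[x, aK] = [x, r_x(s) aK]` for `art_L(s) = σ|L^ab` — the formula of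
`IsCanonicalDescentAt` with base `E` in place of `L` (B-plan2's `IsCanonicalDescentAt_E`; at `E = L`, `ιE = τ` it
IS `IsCanonicalDescentAt`, definitionally).  Printed mechanism: F1 over `E♯` (Deligne 1979 2.3.1 read on
`(G̃,X̃) ↪ GSp(W₀ ⊕ V)`; proof = RSZ/Kottwitz PEL moduli + [Liu2021] Lemma C.18 uniformisation + Shimura–Taniyama at
CM points), F2a (Deligne 1971 Prop. 5.11, finite quotient (5.11.1)), F2b (Cor. 5.7: the clopen sub-tower
`Sc.Mc × {[1]}` descends), then base change `E♯ → E`.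
Strategy hints: «assemble F1 ∘ F2a ∘ F2b at `E := E♯_Φ` BY NAME, then base-change the `E♯`-form along `E♯ ⊆ E`
(reciprocity for the SMALLER group `Aut(ℂ/E)`; `baseChangeHom` composition + `AlgPoints.baseChangeEquiv`
naturality)»; the only fan-A mathematics is the base-change bookkeeping (S–M).
Why it might fail as typed: the torus-reciprocity direction (ref2 check C-r: `p ↦ reflexTwist Φ s · p` vs its
inverse) and the adaptedness convention C-Φ must match `recipFactor L s = c(s)/s` of `IsDiagTwist`; a sign slip
there makes F1 MIRROR-TYPED, hence unprovable as typed, and this assembly idle (nothing false is proved) — cheapest check: the `U(1)`/CM-point case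
`K₀` tiny, `L = ℚ(ζ₇)`-type Galois field, compare with [Milne2005ShimuraVarieties] (62) worked example p. 115.
[cite: Deligne1979ShimuraVarieties, 2.3.1, 2.2.5] [cite: Deligne1971TravauxShimura, Prop. 5.11, Cor. 5.7, §6 pp. 39–40]
[cite: Liu2021, App. C (C.4)–(C.6), Lemma C.14, Rem. C.15, Def. C.16–Lemma C.18]
[cite: RapoportSmithlingZhang2017, §3.2–§3.5] [cite: Kottwitz1992, §5, §8] -/
theorem stub_reflexCompositumModel :
    ∀ (L : Type) [Field L] [NumberField L] [IsCMField L] (H : Matrix (Fin 3) (Fin 3) L) (τ : L →+* ℂ)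
      (T : GL (Fin 3) ℂ) (hT : formCongr (starRingEnd ℂ) T (H.map τ) = BallModel.J),
      (∀ τ' : L →+* ℂ, InfinitePlace.mk τ' ≠ InfinitePlace.mk τ → (H.map τ').PosDef) →
      (∀ v : Fin 3 → L, hermForm (cmConjRingHom L) H v v = 0 → v = 0) →
      ∀ K₀ : C5.OpenCompactSubgroup ↥(finAdelic (↥(maximalRealSubfield L)) L (IsCMField.complexConj L) 3 H),
        (∀ g : finAdelic (↥(maximalRealSubfield L)) L (IsCMField.complexConj L) 3 H,
          ∀ γ ∈ arithmeticLevel (↥(maximalRealSubfield L)) L (IsCMField.complexConj L) 3 H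
            (K₀.1.map (MulAut.conj g).toMonoidHom), IsOfFinOrder γ → γ = 1) →
          ∀ Sc : ComplexRecordSystem L H τ T hT K₀,
            ∃ Φ : CMType L, ∀ (E : Type) [Field E] [NumberField E] (ιE : E →+* ℂ),
              Set.range τ ⊆ Set.range ιE → (traceField Φ : Set ℂ) ⊆ Set.range ιE →
              ∃ (M : C5.SmallLevel K₀ ⥤ SchemeOver E) (e : (M ⋙ baseChangeHom ιE) ≅ Sc.Mc),
              letI : Algebra E ℂ := ιE.toAlgebra
              ∀ (K : C5.SmallLevel K₀) (σ : ℂ ≃ₐ[E] ℂ) (s : (FiniteAdeleRing (𝓞 L) L)ˣ),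
                IsArtinCorrespondent L τ s σ.toRingEquiv →
                ∀ (v₃ : Fin 3 → L) (x : Ball), IsLinePoint L τ T v₃ x →
                  ∀ d : finAdelic (↥(maximalRealSubfield L)) L (IsCMField.complexConj L) 3 H,
                    IsDiagTwist L H v₃ (recipFactor L s) d →
                    ∀ a : finAdelic (↥(maximalRealSubfield L)) L (IsCMField.complexConj L) 3 H,
                      σ • (AlgPoints.baseChangeEquiv ιE (M.obj K)).symm
                          (AlgPoints.map (e.inv.app K) ((Sc.pts K).symm (ShimuraSet.mk L H τ T hT K.1.1 x a))) =
                        (AlgPoints.baseChangeEquiv ιE (M.obj K)).symm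
                          (AlgPoints.map (e.inv.app K)
                            ((Sc.pts K).symm (ShimuraSet.mk L H τ T hT K.1.1 x (d * a)))) := by
  -- FILLED BY NAME modulo the fact stub `stub_F1` (ruling D-CLOSURE (i)): A-p05, p597370 ACCEPTED
  -- (Summits/HodgeConjecture/CorCM/HypDel/A1ReflexCompositumModelOfF1.lean; all L, general reflex degree)
  exact stub_reflexCompositumModel_of_F1 stub_F1

/-- **stub (B) `stub_reflexDescent` (RESIDUAL INTERFACE — Deligne 1979, 2.7.10–2.7.21 «TIER G»: descent from the
reflex composita `E♯_Φ` to the reflex field `E(G,X) = τ(L)`):** if, for some CM type `Φ` of `L`, the complex tower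
has `E`-forms with reciprocity over every number field `E ⊇ τ(L)·E*(Φ)` inside `ℂ` (the conclusion of stub (A)), then
it has an `L`-form along `τ` with reciprocity — the conclusion of `canonicalModel_exists_form`.  For `L/ℚ` Galois
this is PROVED below (`reflexDescent_of_isGalois`: `E := L`, `ιE := τ`, as `E*(Φ) ⊆ τ(L)`); for non-Galois `L` it is
exactly the abelian-type descent of [Deligne1979ShimuraVarieties] 2.7 (rows G-3/G-4 of `B1-SPEC.md` §3:
2.7.13/2.7.18; [Milne2005ShimuraVarieties] Thm. 14.15–Prop. 14.16; alternatively Milne–Shih/Borovoi conjugation),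
for which the tree has no carriers yet (no general Shimura datum / connected-component formalism, D-G1…D-G9).
Strategy hints: (i) «Galois edition β»: if gate5 re-types `hDel` with `[IsGalois ℚ L]` (all the headline needs),
this stub is discharged by `reflexDescent_of_isGalois` and disappears; (ii) «descent by uniqueness»: forms over
`E♯_Φ` for ALL `Φ` plus `canonicalModel_unique_printed` (row I-4) give descent data to `⋂_Φ E♯_Φ`, which may
still exceed `τ(L)` ([Liu2021] Rem. C.15) — census this before (iii) the 2.7 formalism (TIER G).
Why it might fail as typed: it cannot fail logically (it is implied by `hDel` itself: the conclusion is Deligne's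
theorem), but no proof short of Deligne 2.7 / Milne–Shih is known for non-Galois `L`; residual by design.
[cite: Deligne1979ShimuraVarieties, 2.7.10–2.7.21 (PDF pp. 47–52 of Milne's translation)]
[cite: Milne2005ShimuraVarieties, Thm. 14.15–Rem. 14.17 pp. 127–128] [cite: Liu2021, Rem. C.15]
[cite: Deligne1971TravauxShimura, Prop. 5.10 p. 157] -/
theorem stub_reflexDescent :
    ∀ (L : Type) [Field L] [NumberField L] [IsCMField L] (H : Matrix (Fin 3) (Fin 3) L) (τ : L →+* ℂ)
      (T : GL (Fin 3) ℂ) (hT : formCongr (starRingEnd ℂ) T (H.map τ) = BallModel.J),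
      (∀ τ' : L →+* ℂ, InfinitePlace.mk τ' ≠ InfinitePlace.mk τ → (H.map τ').PosDef) →
      (∀ v : Fin 3 → L, hermForm (cmConjRingHom L) H v v = 0 → v = 0) →
      ∀ K₀ : C5.OpenCompactSubgroup ↥(finAdelic (↥(maximalRealSubfield L)) L (IsCMField.complexConj L) 3 H),
        (∀ g : finAdelic (↥(maximalRealSubfield L)) L (IsCMField.complexConj L) 3 H,
          ∀ γ ∈ arithmeticLevel (↥(maximalRealSubfield L)) L (IsCMField.complexConj L) 3 H
            (K₀.1.map (MulAut.conj g).toMonoidHom), IsOfFinOrder γ → γ = 1) →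
          ∀ Sc : ComplexRecordSystem L H τ T hT K₀,
            (∃ Φ : CMType L, ∀ (E : Type) [Field E] [NumberField E] (ιE : E →+* ℂ),
              Set.range τ ⊆ Set.range ιE → (traceField Φ : Set ℂ) ⊆ Set.range ιE →
              ∃ (M : C5.SmallLevel K₀ ⥤ SchemeOver E) (e : (M ⋙ baseChangeHom ιE) ≅ Sc.Mc),
              letI : Algebra E ℂ := ιE.toAlgebra
              ∀ (K : C5.SmallLevel K₀) (σ : ℂ ≃ₐ[E] ℂ) (s : (FiniteAdeleRing (𝓞 L) L)ˣ),
                IsArtinCorrespondent L τ s σ.toRingEquiv →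
                ∀ (v₃ : Fin 3 → L) (x : Ball), IsLinePoint L τ T v₃ x →
                  ∀ d : finAdelic (↥(maximalRealSubfield L)) L (IsCMField.complexConj L) 3 H,
                    IsDiagTwist L H v₃ (recipFactor L s) d →
                    ∀ a : finAdelic (↥(maximalRealSubfield L)) L (IsCMField.complexConj L) 3 H,
                      σ • (AlgPoints.baseChangeEquiv ιE (M.obj K)).symm
                          (AlgPoints.map (e.inv.app K) ((Sc.pts K).symm (ShimuraSet.mk L H τ T hT K.1.1 x a))) =
                        (AlgPoints.baseChangeEquiv ιE (M.obj K)).symm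
                          (AlgPoints.map (e.inv.app K)
                            ((Sc.pts K).symm (ShimuraSet.mk L H τ T hT K.1.1 x (d * a))))) →
            ∃ (M : C5.SmallLevel K₀ ⥤ SchemeOver L) (e : (M ⋙ baseChangeHom τ) ≅ Sc.Mc),
              IsCanonicalDescentAt Sc M e := by
  sorry

/-- **The residual stub (B) is EMPTY for Galois `L`** (PROVED): with `E := L`, `ιE := τ` the compositum
hypothesis holds because `E*(Φ) = traceField Φ ⊆ τ(L)` for `L/ℚ` Galois (`traceField_le_fieldRange`,
[Shimura1998] §8.3 Prop. 28; B1-SPEC I-2c), and the `E`-reciprocity formula at `E = L` IS `IsCanonicalDescentAt`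
(definitionally). [cite: Shimura1998, §8.3 Prop. 28] -/
theorem reflexDescent_of_isGalois :
    ∀ (L : Type) [Field L] [NumberField L] [IsCMField L] [IsGalois ℚ L] (H : Matrix (Fin 3) (Fin 3) L) (τ : L →+* ℂ)
      (T : GL (Fin 3) ℂ) (hT : formCongr (starRingEnd ℂ) T (H.map τ) = BallModel.J),
      (∀ τ' : L →+* ℂ, InfinitePlace.mk τ' ≠ InfinitePlace.mk τ → (H.map τ').PosDef) →
      (∀ v : Fin 3 → L, hermForm (cmConjRingHom L) H v v = 0 → v = 0) →
      ∀ K₀ : C5.OpenCompactSubgroup ↥(finAdelic (↥(maximalRealSubfield L)) L (IsCMField.complexConj L) 3 H),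
        (∀ g : finAdelic (↥(maximalRealSubfield L)) L (IsCMField.complexConj L) 3 H,
          ∀ γ ∈ arithmeticLevel (↥(maximalRealSubfield L)) L (IsCMField.complexConj L) 3 H
            (K₀.1.map (MulAut.conj g).toMonoidHom), IsOfFinOrder γ → γ = 1) →
          ∀ Sc : ComplexRecordSystem L H τ T hT K₀,
            (∃ Φ : CMType L, ∀ (E : Type) [Field E] [NumberField E] (ιE : E →+* ℂ),
              Set.range τ ⊆ Set.range ιE → (traceField Φ : Set ℂ) ⊆ Set.range ιE →
              ∃ (M : C5.SmallLevel K₀ ⥤ SchemeOver E) (e : (M ⋙ baseChangeHom ιE) ≅ Sc.Mc),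
              letI : Algebra E ℂ := ιE.toAlgebra
              ∀ (K : C5.SmallLevel K₀) (σ : ℂ ≃ₐ[E] ℂ) (s : (FiniteAdeleRing (𝓞 L) L)ˣ),
                IsArtinCorrespondent L τ s σ.toRingEquiv →
                ∀ (v₃ : Fin 3 → L) (x : Ball), IsLinePoint L τ T v₃ x →
                  ∀ d : finAdelic (↥(maximalRealSubfield L)) L (IsCMField.complexConj L) 3 H,
                    IsDiagTwist L H v₃ (recipFactor L s) d →
                    ∀ a : finAdelic (↥(maximalRealSubfield L)) L (IsCMField.complexConj L) 3 H,
                      σ • (AlgPoints.baseChangeEquiv ιE (M.obj K)).symm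
                          (AlgPoints.map (e.inv.app K) ((Sc.pts K).symm (ShimuraSet.mk L H τ T hT K.1.1 x a))) =
                        (AlgPoints.baseChangeEquiv ιE (M.obj K)).symm
                          (AlgPoints.map (e.inv.app K)
                            ((Sc.pts K).symm (ShimuraSet.mk L H τ T hT K.1.1 x (d * a))))) →
            ∃ (M : C5.SmallLevel K₀ ⥤ SchemeOver L) (e : (M ⋙ baseChangeHom τ) ≅ Sc.Mc),
              IsCanonicalDescentAt Sc M e := by
  intro L _ _ _ _ H τ T hT hpos hanis K₀ htf Sc hA
  obtain ⟨Φ, hΦ⟩ := hA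
  have hE : (traceField Φ : Set ℂ) ⊆ Set.range τ := by
    intro x hx
    obtain ⟨y, hy⟩ := AlgHom.mem_fieldRange.1 (traceField_le_fieldRange (AlgHom.id ℚ L) τ Φ hx)
    exact ⟨y, by simpa using hy⟩
  obtain ⟨M, e, hrec⟩ := hΦ L τ subset_rfl hE
  exact ⟨M, e, hrec⟩

/-- **COMPOSITION (kernel-checked, mechanism shape): (A) Chain B over the reflex composita + (B) descent to the
reflex field ⟹ `hDel`.**  Modus ponens per `(L, H, τ, T, K₀, Sc)`, then the print's `smooth` / `projective`
clauses by `canonicalModel_exists_printed_iff_form` (they descend along `τ`).  This is `HypDel_of`.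
[cite: Deligne1979ShimuraVarieties, 2.2.5 and Cor. 2.7.21] -/
theorem canonicalModel_exists_printed_of
    (hA : ∀ (L : Type) [Field L] [NumberField L] [IsCMField L] (H : Matrix (Fin 3) (Fin 3) L) (τ : L →+* ℂ)
      (T : GL (Fin 3) ℂ) (hT : formCongr (starRingEnd ℂ) T (H.map τ) = BallModel.J),
      (∀ τ' : L →+* ℂ, InfinitePlace.mk τ' ≠ InfinitePlace.mk τ → (H.map τ').PosDef) →
      (∀ v : Fin 3 → L, hermForm (cmConjRingHom L) H v v = 0 → v = 0) →
      ∀ K₀ : C5.OpenCompactSubgroup ↥(finAdelic (↥(maximalRealSubfield L)) L (IsCMField.complexConj L) 3 H),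
        (∀ g : finAdelic (↥(maximalRealSubfield L)) L (IsCMField.complexConj L) 3 H,
          ∀ γ ∈ arithmeticLevel (↥(maximalRealSubfield L)) L (IsCMField.complexConj L) 3 H
            (K₀.1.map (MulAut.conj g).toMonoidHom), IsOfFinOrder γ → γ = 1) →
          ∀ Sc : ComplexRecordSystem L H τ T hT K₀,
            ∃ Φ : CMType L, ∀ (E : Type) [Field E] [NumberField E] (ιE : E →+* ℂ),
              Set.range τ ⊆ Set.range ιE → (traceField Φ : Set ℂ) ⊆ Set.range ιE →
              ∃ (M : C5.SmallLevel K₀ ⥤ SchemeOver E) (e : (M ⋙ baseChangeHom ιE) ≅ Sc.Mc),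
              letI : Algebra E ℂ := ιE.toAlgebra
              ∀ (K : C5.SmallLevel K₀) (σ : ℂ ≃ₐ[E] ℂ) (s : (FiniteAdeleRing (𝓞 L) L)ˣ),
                IsArtinCorrespondent L τ s σ.toRingEquiv →
                ∀ (v₃ : Fin 3 → L) (x : Ball), IsLinePoint L τ T v₃ x →
                  ∀ d : finAdelic (↥(maximalRealSubfield L)) L (IsCMField.complexConj L) 3 H,
                    IsDiagTwist L H v₃ (recipFactor L s) d →
                    ∀ a : finAdelic (↥(maximalRealSubfield L)) L (IsCMField.complexConj L) 3 H,
                      σ • (AlgPoints.baseChangeEquiv ιE (M.obj K)).symm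
                          (AlgPoints.map (e.inv.app K) ((Sc.pts K).symm (ShimuraSet.mk L H τ T hT K.1.1 x a))) =
                        (AlgPoints.baseChangeEquiv ιE (M.obj K)).symm
                          (AlgPoints.map (e.inv.app K)
                            ((Sc.pts K).symm (ShimuraSet.mk L H τ T hT K.1.1 x (d * a)))))
    (hB : ∀ (L : Type) [Field L] [NumberField L] [IsCMField L] (H : Matrix (Fin 3) (Fin 3) L) (τ : L →+* ℂ)
      (T : GL (Fin 3) ℂ) (hT : formCongr (starRingEnd ℂ) T (H.map τ) = BallModel.J),
      (∀ τ' : L →+* ℂ, InfinitePlace.mk τ' ≠ InfinitePlace.mk τ → (H.map τ').PosDef) →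
      (∀ v : Fin 3 → L, hermForm (cmConjRingHom L) H v v = 0 → v = 0) →
      ∀ K₀ : C5.OpenCompactSubgroup ↥(finAdelic (↥(maximalRealSubfield L)) L (IsCMField.complexConj L) 3 H),
        (∀ g : finAdelic (↥(maximalRealSubfield L)) L (IsCMField.complexConj L) 3 H,
          ∀ γ ∈ arithmeticLevel (↥(maximalRealSubfield L)) L (IsCMField.complexConj L) 3 H
            (K₀.1.map (MulAut.conj g).toMonoidHom), IsOfFinOrder γ → γ = 1) →
          ∀ Sc : ComplexRecordSystem L H τ T hT K₀,
            (∃ Φ : CMType L, ∀ (E : Type) [Field E] [NumberField E] (ιE : E →+* ℂ),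
              Set.range τ ⊆ Set.range ιE → (traceField Φ : Set ℂ) ⊆ Set.range ιE →
              ∃ (M : C5.SmallLevel K₀ ⥤ SchemeOver E) (e : (M ⋙ baseChangeHom ιE) ≅ Sc.Mc),
              letI : Algebra E ℂ := ιE.toAlgebra
              ∀ (K : C5.SmallLevel K₀) (σ : ℂ ≃ₐ[E] ℂ) (s : (FiniteAdeleRing (𝓞 L) L)ˣ),
                IsArtinCorrespondent L τ s σ.toRingEquiv →
                ∀ (v₃ : Fin 3 → L) (x : Ball), IsLinePoint L τ T v₃ x →
                  ∀ d : finAdelic (↥(maximalRealSubfield L)) L (IsCMField.complexConj L) 3 H,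
                    IsDiagTwist L H v₃ (recipFactor L s) d →
                    ∀ a : finAdelic (↥(maximalRealSubfield L)) L (IsCMField.complexConj L) 3 H,
                      σ • (AlgPoints.baseChangeEquiv ιE (M.obj K)).symm
                          (AlgPoints.map (e.inv.app K) ((Sc.pts K).symm (ShimuraSet.mk L H τ T hT K.1.1 x a))) =
                        (AlgPoints.baseChangeEquiv ιE (M.obj K)).symm
                          (AlgPoints.map (e.inv.app K)
                            ((Sc.pts K).symm (ShimuraSet.mk L H τ T hT K.1.1 x (d * a))))) →
            ∃ (M : C5.SmallLevel K₀ ⥤ SchemeOver L) (e : (M ⋙ baseChangeHom τ) ≅ Sc.Mc),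
              IsCanonicalDescentAt Sc M e) :
    canonicalModel_exists_printed :=
  canonicalModel_exists_printed_iff_form.2 fun L _ _ _ H τ T hT hpos hanis K₀ htf Sc =>
    hB L H τ T hT hpos hanis K₀ htf Sc (hA L H τ T hT hpos hanis K₀ htf Sc)

/-! ## The case-split shape of ruling D-I2 (interim, binding): `GaloisCase → NonGaloisResidual → hDel` -/

/-- **stub `stub_galoisCase` (= «StubGaloisCase» of ruling D-I2; NOT a leaf: PROVED from stub (A) below as
`galoisCase_of_reflexCompositumModel`)** — the conclusion of `canonicalModel_exists_form` for GALOIS CM fields `L`: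
an `L`-form of `Sc.Mc` along `τ` with reciprocity (62).  This is the Galois edition `hDel♭` of the binder
(pointwise), the only case the headline consumes (`F` Galois, `6 ≤ [F:ℚ]`).  Strategy hint: «Chain B at `E := L`»
— do not attack directly; close `stub_reflexCompositumModel` and apply `galoisCase_of_reflexCompositumModel`.
Why it might fail: only through stub (A) (conventions C-Φ / C-r), see there.
[cite: Deligne1979ShimuraVarieties, 2.2.5] [cite: Deligne1971TravauxShimura, Prop. 5.11, Cor. 5.7]
[cite: Liu2021, Lemma C.14, Rem. C.15] -/
theorem stub_galoisCase :
    ∀ (L : Type) [Field L] [NumberField L] [IsCMField L] [IsGalois ℚ L] (H : Matrix (Fin 3) (Fin 3) L) (τ : L →+* ℂ)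
      (T : GL (Fin 3) ℂ) (hT : formCongr (starRingEnd ℂ) T (H.map τ) = BallModel.J),
      (∀ τ' : L →+* ℂ, InfinitePlace.mk τ' ≠ InfinitePlace.mk τ → (H.map τ').PosDef) →
      (∀ v : Fin 3 → L, hermForm (cmConjRingHom L) H v v = 0 → v = 0) →
      ∀ K₀ : C5.OpenCompactSubgroup ↥(finAdelic (↥(maximalRealSubfield L)) L (IsCMField.complexConj L) 3 H),
        (∀ g : finAdelic (↥(maximalRealSubfield L)) L (IsCMField.complexConj L) 3 H,
          ∀ γ ∈ arithmeticLevel (↥(maximalRealSubfield L)) L (IsCMField.complexConj L) 3 H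
            (K₀.1.map (MulAut.conj g).toMonoidHom), IsOfFinOrder γ → γ = 1) →
          ∀ Sc : ComplexRecordSystem L H τ T hT K₀,
            ∃ (M : C5.SmallLevel K₀ ⥤ SchemeOver L) (e : (M ⋙ baseChangeHom τ) ≅ Sc.Mc),
              IsCanonicalDescentAt Sc M e := by
  -- FILLED BY NAME modulo the fact stub `stub_F1` (ruling D-CLOSURE (i)): A-p06, p596634 ACCEPTED
  -- (Summits/HodgeConjecture/CorCM/HypDel/HypDelGaloisCaseOfF1.lean)
  exact Summit.HodgeConjecture.CorCM.HypDel.galoisCase_of_F1 stub_F1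

/-- **stub `stub_nonGaloisResidual` (= «StubNonGaloisResidual» of ruling D-I2; TIER-G home, Chain A):** the
conclusion of `canonicalModel_exists_form` for NON-Galois CM fields `L`.  Under β (Galois edition) this stub is
deleted; under α it is the declared TIER-G crux, to be derived from `stub_reflexDescent` (Deligne 1979
2.7.13/2.7.18, rows G-3/G-4) — `nonGaloisResidual_of_reflexDescent` below shows (A) + (B) ⟹ this stub, so no
prover should attack it before TIER G is typed.  Strategy hint: «reduction to the Galois closure + Milne–Shih
conjugation», census first.  Why it might fail: cannot (implied by `hDel`); residual by design.
[cite: Deligne1979ShimuraVarieties, Cor. 2.7.21] [cite: Milne2005ShimuraVarieties, Thm. 14.15–Prop. 14.16] -/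
theorem stub_nonGaloisResidual :
    ∀ (L : Type) [Field L] [NumberField L] [IsCMField L], ¬ IsGalois ℚ L →
      ∀ (H : Matrix (Fin 3) (Fin 3) L) (τ : L →+* ℂ)
      (T : GL (Fin 3) ℂ) (hT : formCongr (starRingEnd ℂ) T (H.map τ) = BallModel.J),
      (∀ τ' : L →+* ℂ, InfinitePlace.mk τ' ≠ InfinitePlace.mk τ → (H.map τ').PosDef) →
      (∀ v : Fin 3 → L, hermForm (cmConjRingHom L) H v v = 0 → v = 0) →
      ∀ K₀ : C5.OpenCompactSubgroup ↥(finAdelic (↥(maximalRealSubfield L)) L (IsCMField.complexConj L) 3 H),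
        (∀ g : finAdelic (↥(maximalRealSubfield L)) L (IsCMField.complexConj L) 3 H,
          ∀ γ ∈ arithmeticLevel (↥(maximalRealSubfield L)) L (IsCMField.complexConj L) 3 H
            (K₀.1.map (MulAut.conj g).toMonoidHom), IsOfFinOrder γ → γ = 1) →
          ∀ Sc : ComplexRecordSystem L H τ T hT K₀,
            ∃ (M : C5.SmallLevel K₀ ⥤ SchemeOver L) (e : (M ⋙ baseChangeHom τ) ≅ Sc.Mc),
              IsCanonicalDescentAt Sc M e := by
  -- DERIVED in-file (bookkeeping of `nonGaloisResidual_of_reflexDescent`): stub (A) [closed modulo F1] + stub (B)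
  -- [`stub_reflexDescent`, the TIER-G RESIDUAL, still `sorry`] — so this node carries NO debt of its own; its debt IS (B).
  intro L _ _ _ _ H τ T hT hpos hanis K₀ htf Sc
  exact stub_reflexDescent L H τ T hT hpos hanis K₀ htf Sc (stub_reflexCompositumModel L H τ T hT hpos hanis K₀ htf Sc)

/-- **COMPOSITION (kernel-checked, ruling D-I2 shape): `GaloisCase → NonGaloisResidual → hDel`** — case split on
`IsGalois ℚ L`, then `canonicalModel_exists_printed_iff_form`. [cite: Deligne1979ShimuraVarieties, 2.2.5, 2.7.21] -/
theorem canonicalModel_exists_printed_of_cases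
    (hG : ∀ (L : Type) [Field L] [NumberField L] [IsCMField L] [IsGalois ℚ L] (H : Matrix (Fin 3) (Fin 3) L) (τ : L →+* ℂ)
      (T : GL (Fin 3) ℂ) (hT : formCongr (starRingEnd ℂ) T (H.map τ) = BallModel.J),
      (∀ τ' : L →+* ℂ, InfinitePlace.mk τ' ≠ InfinitePlace.mk τ → (H.map τ').PosDef) →
      (∀ v : Fin 3 → L, hermForm (cmConjRingHom L) H v v = 0 → v = 0) →
      ∀ K₀ : C5.OpenCompactSubgroup ↥(finAdelic (↥(maximalRealSubfield L)) L (IsCMField.complexConj L) 3 H),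
        (∀ g : finAdelic (↥(maximalRealSubfield L)) L (IsCMField.complexConj L) 3 H,
          ∀ γ ∈ arithmeticLevel (↥(maximalRealSubfield L)) L (IsCMField.complexConj L) 3 H
            (K₀.1.map (MulAut.conj g).toMonoidHom), IsOfFinOrder γ → γ = 1) →
          ∀ Sc : ComplexRecordSystem L H τ T hT K₀,
            ∃ (M : C5.SmallLevel K₀ ⥤ SchemeOver L) (e : (M ⋙ baseChangeHom τ) ≅ Sc.Mc),
              IsCanonicalDescentAt Sc M e)
    (hN : ∀ (L : Type) [Field L] [NumberField L] [IsCMField L], ¬ IsGalois ℚ L →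
      ∀ (H : Matrix (Fin 3) (Fin 3) L) (τ : L →+* ℂ)
      (T : GL (Fin 3) ℂ) (hT : formCongr (starRingEnd ℂ) T (H.map τ) = BallModel.J),
      (∀ τ' : L →+* ℂ, InfinitePlace.mk τ' ≠ InfinitePlace.mk τ → (H.map τ').PosDef) →
      (∀ v : Fin 3 → L, hermForm (cmConjRingHom L) H v v = 0 → v = 0) →
      ∀ K₀ : C5.OpenCompactSubgroup ↥(finAdelic (↥(maximalRealSubfield L)) L (IsCMField.complexConj L) 3 H),
        (∀ g : finAdelic (↥(maximalRealSubfield L)) L (IsCMField.complexConj L) 3 H,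
          ∀ γ ∈ arithmeticLevel (↥(maximalRealSubfield L)) L (IsCMField.complexConj L) 3 H
            (K₀.1.map (MulAut.conj g).toMonoidHom), IsOfFinOrder γ → γ = 1) →
          ∀ Sc : ComplexRecordSystem L H τ T hT K₀,
            ∃ (M : C5.SmallLevel K₀ ⥤ SchemeOver L) (e : (M ⋙ baseChangeHom τ) ≅ Sc.Mc),
              IsCanonicalDescentAt Sc M e) :
    canonicalModel_exists_printed :=
  canonicalModel_exists_printed_iff_form.2 fun L _ _ _ H τ T hT hpos hanis K₀ htf Sc => by
    by_cases hL : IsGalois ℚ L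
    · exact hG L H τ T hT hpos hanis K₀ htf Sc
    · exact hN L hL H τ T hT hpos hanis K₀ htf Sc

/-- **`GaloisCase` from stub (A) alone (PROVED)** — Chain B at `E := L` via `reflexDescent_of_isGalois`.  Hence under
the Galois edition β the whole of `hDel♭` rests on `stub_reflexCompositumModel` (rows I-1, I-2 F2a/F2b, II-1).
[cite: Deligne1971TravauxShimura, Prop. 5.11, Cor. 5.7] [cite: Shimura1998, §8.3 Prop. 28] -/
theorem galoisCase_of_reflexCompositumModel
    (hA : ∀ (L : Type) [Field L] [NumberField L] [IsCMField L] (H : Matrix (Fin 3) (Fin 3) L) (τ : L →+* ℂ)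
      (T : GL (Fin 3) ℂ) (hT : formCongr (starRingEnd ℂ) T (H.map τ) = BallModel.J),
      (∀ τ' : L →+* ℂ, InfinitePlace.mk τ' ≠ InfinitePlace.mk τ → (H.map τ').PosDef) →
      (∀ v : Fin 3 → L, hermForm (cmConjRingHom L) H v v = 0 → v = 0) →
      ∀ K₀ : C5.OpenCompactSubgroup ↥(finAdelic (↥(maximalRealSubfield L)) L (IsCMField.complexConj L) 3 H),
        (∀ g : finAdelic (↥(maximalRealSubfield L)) L (IsCMField.complexConj L) 3 H,
          ∀ γ ∈ arithmeticLevel (↥(maximalRealSubfield L)) L (IsCMField.complexConj L) 3 H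
            (K₀.1.map (MulAut.conj g).toMonoidHom), IsOfFinOrder γ → γ = 1) →
          ∀ Sc : ComplexRecordSystem L H τ T hT K₀,
            ∃ Φ : CMType L, ∀ (E : Type) [Field E] [NumberField E] (ιE : E →+* ℂ),
              Set.range τ ⊆ Set.range ιE → (traceField Φ : Set ℂ) ⊆ Set.range ιE →
              ∃ (M : C5.SmallLevel K₀ ⥤ SchemeOver E) (e : (M ⋙ baseChangeHom ιE) ≅ Sc.Mc),
              letI : Algebra E ℂ := ιE.toAlgebra
              ∀ (K : C5.SmallLevel K₀) (σ : ℂ ≃ₐ[E] ℂ) (s : (FiniteAdeleRing (𝓞 L) L)ˣ),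
                IsArtinCorrespondent L τ s σ.toRingEquiv →
                ∀ (v₃ : Fin 3 → L) (x : Ball), IsLinePoint L τ T v₃ x →
                  ∀ d : finAdelic (↥(maximalRealSubfield L)) L (IsCMField.complexConj L) 3 H,
                    IsDiagTwist L H v₃ (recipFactor L s) d →
                    ∀ a : finAdelic (↥(maximalRealSubfield L)) L (IsCMField.complexConj L) 3 H,
                      σ • (AlgPoints.baseChangeEquiv ιE (M.obj K)).symm
                          (AlgPoints.map (e.inv.app K) ((Sc.pts K).symm (ShimuraSet.mk L H τ T hT K.1.1 x a))) =
                        (AlgPoints.baseChangeEquiv ιE (M.obj K)).symm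
                          (AlgPoints.map (e.inv.app K)
                            ((Sc.pts K).symm (ShimuraSet.mk L H τ T hT K.1.1 x (d * a))))) :
    ∀ (L : Type) [Field L] [NumberField L] [IsCMField L] [IsGalois ℚ L] (H : Matrix (Fin 3) (Fin 3) L) (τ : L →+* ℂ)
      (T : GL (Fin 3) ℂ) (hT : formCongr (starRingEnd ℂ) T (H.map τ) = BallModel.J),
      (∀ τ' : L →+* ℂ, InfinitePlace.mk τ' ≠ InfinitePlace.mk τ → (H.map τ').PosDef) →
      (∀ v : Fin 3 → L, hermForm (cmConjRingHom L) H v v = 0 → v = 0) →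
      ∀ K₀ : C5.OpenCompactSubgroup ↥(finAdelic (↥(maximalRealSubfield L)) L (IsCMField.complexConj L) 3 H),
        (∀ g : finAdelic (↥(maximalRealSubfield L)) L (IsCMField.complexConj L) 3 H,
          ∀ γ ∈ arithmeticLevel (↥(maximalRealSubfield L)) L (IsCMField.complexConj L) 3 H
            (K₀.1.map (MulAut.conj g).toMonoidHom), IsOfFinOrder γ → γ = 1) →
          ∀ Sc : ComplexRecordSystem L H τ T hT K₀,
            ∃ (M : C5.SmallLevel K₀ ⥤ SchemeOver L) (e : (M ⋙ baseChangeHom τ) ≅ Sc.Mc),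
              IsCanonicalDescentAt Sc M e := by
  intro L _ _ _ _ H τ T hT hpos hanis K₀ htf Sc
  exact reflexDescent_of_isGalois L H τ T hT hpos hanis K₀ htf Sc (hA L H τ T hT hpos hanis K₀ htf Sc)

/-- **`NonGaloisResidual` from (A) + (B) (PROVED, bookkeeping)** — so the TIER-G content sits in `stub_reflexDescent`
alone. [cite: Deligne1979ShimuraVarieties, Cor. 2.7.21] -/
theorem nonGaloisResidual_of_reflexDescent
    (hA : ∀ (L : Type) [Field L] [NumberField L] [IsCMField L] (H : Matrix (Fin 3) (Fin 3) L) (τ : L →+* ℂ)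
      (T : GL (Fin 3) ℂ) (hT : formCongr (starRingEnd ℂ) T (H.map τ) = BallModel.J),
      (∀ τ' : L →+* ℂ, InfinitePlace.mk τ' ≠ InfinitePlace.mk τ → (H.map τ').PosDef) →
      (∀ v : Fin 3 → L, hermForm (cmConjRingHom L) H v v = 0 → v = 0) →
      ∀ K₀ : C5.OpenCompactSubgroup ↥(finAdelic (↥(maximalRealSubfield L)) L (IsCMField.complexConj L) 3 H),
        (∀ g : finAdelic (↥(maximalRealSubfield L)) L (IsCMField.complexConj L) 3 H,
          ∀ γ ∈ arithmeticLevel (↥(maximalRealSubfield L)) L (IsCMField.complexConj L) 3 H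
            (K₀.1.map (MulAut.conj g).toMonoidHom), IsOfFinOrder γ → γ = 1) →
          ∀ Sc : ComplexRecordSystem L H τ T hT K₀,
            ∃ Φ : CMType L, ∀ (E : Type) [Field E] [NumberField E] (ιE : E →+* ℂ),
              Set.range τ ⊆ Set.range ιE → (traceField Φ : Set ℂ) ⊆ Set.range ιE →
              ∃ (M : C5.SmallLevel K₀ ⥤ SchemeOver E) (e : (M ⋙ baseChangeHom ιE) ≅ Sc.Mc),
              letI : Algebra E ℂ := ιE.toAlgebra
              ∀ (K : C5.SmallLevel K₀) (σ : ℂ ≃ₐ[E] ℂ) (s : (FiniteAdeleRing (𝓞 L) L)ˣ),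
                IsArtinCorrespondent L τ s σ.toRingEquiv →
                ∀ (v₃ : Fin 3 → L) (x : Ball), IsLinePoint L τ T v₃ x →
                  ∀ d : finAdelic (↥(maximalRealSubfield L)) L (IsCMField.complexConj L) 3 H,
                    IsDiagTwist L H v₃ (recipFactor L s) d →
                    ∀ a : finAdelic (↥(maximalRealSubfield L)) L (IsCMField.complexConj L) 3 H,
                      σ • (AlgPoints.baseChangeEquiv ιE (M.obj K)).symm
                          (AlgPoints.map (e.inv.app K) ((Sc.pts K).symm (ShimuraSet.mk L H τ T hT K.1.1 x a))) =
                        (AlgPoints.baseChangeEquiv ιE (M.obj K)).symm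
                          (AlgPoints.map (e.inv.app K)
                            ((Sc.pts K).symm (ShimuraSet.mk L H τ T hT K.1.1 x (d * a)))))
    (hB : ∀ (L : Type) [Field L] [NumberField L] [IsCMField L] (H : Matrix (Fin 3) (Fin 3) L) (τ : L →+* ℂ)
      (T : GL (Fin 3) ℂ) (hT : formCongr (starRingEnd ℂ) T (H.map τ) = BallModel.J),
      (∀ τ' : L →+* ℂ, InfinitePlace.mk τ' ≠ InfinitePlace.mk τ → (H.map τ').PosDef) →
      (∀ v : Fin 3 → L, hermForm (cmConjRingHom L) H v v = 0 → v = 0) →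
      ∀ K₀ : C5.OpenCompactSubgroup ↥(finAdelic (↥(maximalRealSubfield L)) L (IsCMField.complexConj L) 3 H),
        (∀ g : finAdelic (↥(maximalRealSubfield L)) L (IsCMField.complexConj L) 3 H,
          ∀ γ ∈ arithmeticLevel (↥(maximalRealSubfield L)) L (IsCMField.complexConj L) 3 H
            (K₀.1.map (MulAut.conj g).toMonoidHom), IsOfFinOrder γ → γ = 1) →
          ∀ Sc : ComplexRecordSystem L H τ T hT K₀,
            (∃ Φ : CMType L, ∀ (E : Type) [Field E] [NumberField E] (ιE : E →+* ℂ),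
              Set.range τ ⊆ Set.range ιE → (traceField Φ : Set ℂ) ⊆ Set.range ιE →
              ∃ (M : C5.SmallLevel K₀ ⥤ SchemeOver E) (e : (M ⋙ baseChangeHom ιE) ≅ Sc.Mc),
              letI : Algebra E ℂ := ιE.toAlgebra
              ∀ (K : C5.SmallLevel K₀) (σ : ℂ ≃ₐ[E] ℂ) (s : (FiniteAdeleRing (𝓞 L) L)ˣ),
                IsArtinCorrespondent L τ s σ.toRingEquiv →
                ∀ (v₃ : Fin 3 → L) (x : Ball), IsLinePoint L τ T v₃ x →
                  ∀ d : finAdelic (↥(maximalRealSubfield L)) L (IsCMField.complexConj L) 3 H,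
                    IsDiagTwist L H v₃ (recipFactor L s) d →
                    ∀ a : finAdelic (↥(maximalRealSubfield L)) L (IsCMField.complexConj L) 3 H,
                      σ • (AlgPoints.baseChangeEquiv ιE (M.obj K)).symm
                          (AlgPoints.map (e.inv.app K) ((Sc.pts K).symm (ShimuraSet.mk L H τ T hT K.1.1 x a))) =
                        (AlgPoints.baseChangeEquiv ιE (M.obj K)).symm
                          (AlgPoints.map (e.inv.app K)
                            ((Sc.pts K).symm (ShimuraSet.mk L H τ T hT K.1.1 x (d * a))))) →
            ∃ (M : C5.SmallLevel K₀ ⥤ SchemeOver L) (e : (M ⋙ baseChangeHom τ) ≅ Sc.Mc),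
              IsCanonicalDescentAt Sc M e) :
    ∀ (L : Type) [Field L] [NumberField L] [IsCMField L], ¬ IsGalois ℚ L →
      ∀ (H : Matrix (Fin 3) (Fin 3) L) (τ : L →+* ℂ)
      (T : GL (Fin 3) ℂ) (hT : formCongr (starRingEnd ℂ) T (H.map τ) = BallModel.J),
      (∀ τ' : L →+* ℂ, InfinitePlace.mk τ' ≠ InfinitePlace.mk τ → (H.map τ').PosDef) →
      (∀ v : Fin 3 → L, hermForm (cmConjRingHom L) H v v = 0 → v = 0) →
      ∀ K₀ : C5.OpenCompactSubgroup ↥(finAdelic (↥(maximalRealSubfield L)) L (IsCMField.complexConj L) 3 H),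
        (∀ g : finAdelic (↥(maximalRealSubfield L)) L (IsCMField.complexConj L) 3 H,
          ∀ γ ∈ arithmeticLevel (↥(maximalRealSubfield L)) L (IsCMField.complexConj L) 3 H
            (K₀.1.map (MulAut.conj g).toMonoidHom), IsOfFinOrder γ → γ = 1) →
          ∀ Sc : ComplexRecordSystem L H τ T hT K₀,
            ∃ (M : C5.SmallLevel K₀ ⥤ SchemeOver L) (e : (M ⋙ baseChangeHom τ) ≅ Sc.Mc),
              IsCanonicalDescentAt Sc M e := by
  intro L _ _ _ _ H τ T hT hpos hanis K₀ htf Sc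
  exact hB L H τ T hT hpos hanis K₀ htf Sc (hA L H τ T hT hpos hanis K₀ htf Sc)

/-- **HEAD BY NAME (gate `skeleton check` shape, route `HCCMUnconditional`, crux item stmt-HodgeConjecture-24835):**
the route decl `HDel` (`:= PrintedCitationHypotheses.HypDel := UnitaryCanonicalModel.canonicalModel_exists_printed`,
both by `rfl`) from this skeleton — edition α: (A) [closed modulo `stub_F1`] + (B) [`stub_reflexDescent`, TIER-G
residual].  Its only `sorryAx` ancestry is `stub_F1` and `stub_reflexDescent`.  HC_CM is proved only modulo the 7
printed citations until rung 0 closes. -/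
theorem HDel_proof : Summit.HodgeConjecture.HodgeConjecture.Theses.HCCMUnconditional.HDel :=
  canonicalModel_exists_printed_of stub_reflexCompositumModel stub_reflexDescent

end Summit.HodgeConjecture.CorCM.Cruxes.HypDel.ReflexCompositum

end
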